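import Literature.Analysis.FluidPDE.DriftHeatKernelProfile
import Literature.Analysis.FluidPDE.RadialCalculus
import Literature.Analysis.UnboundedOperators.HeatKernel
import HarnessLib

/-!
# Drift-robust heat kernels: sub- and supersolutions of `k_t = Δk − a·∇k` for all `‖a‖ ≤ A`

Analysis/FluidPDE support file for the proof of the named fact
`Literature.Analysis.FluidPDE.KNSS2009_lemma21` (KNSS 2009, Lemma 2.1 as printed, on a bounded
domain with `δ` uniform over the solution class). On a finite-dimensional real inner product
space `E` of dimension `n`, for a drift bound `A ≥ 0`, a sign `ε = ±1` and `σ > 0`, the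
**drift-robust heat kernel** is

  `driftKernel ε A σ y = (4πσ)^{-n/2} exp(−‖y‖²/(4σ)) · exp(ε (A√(‖y‖² + σ) + 2(n+1)A√σ + 2A²σ))`
  `= heatKernel σ y · exp(ε (…))` (`driftKernel_eq_heatKernel_mul`),

the Gauss–Weierstrass kernel tilted by `e^{±A√(‖y‖²+σ)}` and renormalised in `σ`. We compute
its gradient (`hasFDerivAt_driftKernel`, `norm_fderiv_driftKernel`), its Laplacian
(`laplacian_driftKernel`, from the radial calculus of `RadialCalculus`) and its `σ`-derivative
(`hasDerivAt_driftKernel_sigma`, the function `driftKernelDt`), prove smoothness of the slices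
and joint continuity of all these quantities on `{σ > 0} × E`, and establish the
**differential inequality** (`driftKernel_ineq`)

  `A ‖∇k_ε‖ ≤ ε (∂_σ k_ε − Δ k_ε)`   (`σ > 0`, all `y`),

i.e. `k₊` is a supersolution (`∂_σ k ≥ Δk + A‖∇k‖ ≥ Δk − a·∇k`) and `k₋` a subsolution
(`∂_σ k ≤ Δk − A‖∇k‖ ≤ Δk − a·∇k`) of the drift–heat equation for *every* measurable drift
`‖a‖ ≤ A` simultaneously; the algebra is `driftKernel_bracket_nonneg` of
`DriftHeatKernelProfile` (the tilt `A√(‖y‖²+σ)` absorbs the adversarial drift term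
`A‖y‖/(2σ) · k`, the renormalisation `2(n+1)A√σ + 2A²σ` the `O(σ^{-1/2})` remainders). Finally
`driftKernel_le` / `le_driftKernel` sandwich `k_ε` between `heatKernel σ y · e^{∓(…)}`, which is
how the kernels are shown to be approximate identities (`DriftHeatApproxIdentity`). Comparison
with the barriers `k_ε ⋆ h` is what turns a pointwise value of a nonnegative solution into a
bound on its local mass and back (`DriftHeatPointToMass`, `DriftHeatMassToBall`), the
quantitative replacement for the compactness/strong-maximum-principle step of the printed proof
of Lemma 2.1.

## References

* G. Koch, N. Nadirashvili, G. Seregin, V. Šverák, *Liouville theorems for the Navier–Stokes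
  equations and applications*, Acta Math. 203 (2009) = arXiv:0709.3599, Lemma 2.1 (p. 5).
  [KochNadirashviliSereginSverak2009]
* G. M. Lieberman, *Second Order Parabolic Differential Equations*, World Scientific (1996),
  Ch. II (comparison with explicit sub/supersolutions). [Lieberman1996]
* L. C. Evans, *Partial Differential Equations*, 2nd ed. (2010), §2.3.1 (the heat kernel).
  [Evans2010]
-/

noncomputable section

open Real Set Filter Topology InnerProductSpace Function Metric
open scoped RealInnerProductSpace Laplacian ContDiff

namespace Literature.Analysis.FluidPDE

variable {E : Type*} [NormedAddCommGroup E] [InnerProductSpace ℝ E]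

/-! ### The kernels -/

/-- **The drift-robust heat kernel** `k_ε(σ, y) = (4πσ)^{-n/2} e^{−‖y‖²/(4σ)} e^{ε(A√(‖y‖²+σ) +
2(n+1)A√σ + 2A²σ)}`, `n = dim E`, as the radial profile `driftKernelProfile` in `s = ‖y‖²`
(junk for `σ ≤ 0`). For `ε = 1` a supersolution, for `ε = −1` a subsolution of
`k_σ = Δk − a·∇k` for every drift `‖a‖ ≤ A` (`driftKernel_ineq`). [folklore] -/
def driftKernel (ε A σ : ℝ) (y : E) : ℝ :=
  driftKernelProfile (Module.finrank ℝ E) ε A σ (‖y‖ ^ 2)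

/-- The `σ`-derivative of `driftKernel` (see `hasDerivAt_driftKernel_sigma`). [folklore] -/
def driftKernelDt (ε A σ : ℝ) (y : E) : ℝ :=
  driftKernel ε A σ y * dkExpT (Module.finrank ℝ E) ε A σ (‖y‖ ^ 2)

/-- `driftKernel = heatKernel · e^{ε(A√(‖y‖²+σ) + 2(n+1)A√σ + 2A²σ)}`. [folklore] -/
theorem driftKernel_eq_heatKernel_mul (ε A σ : ℝ) (y : E) :
    driftKernel ε A σ y = UnboundedOperators.heatKernel σ y *
      exp (ε * (A * √(‖y‖ ^ 2 + σ) + 2 * (Module.finrank ℝ E + 1) * A * √σ + 2 * A ^ 2 * σ)) := by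
  simp only [driftKernel, driftKernelProfile, dkExp, UnboundedOperators.heatKernel, exp_add]
  ring

/-- The kernel is positive for `σ > 0`. [folklore] -/
theorem driftKernel_pos (ε A : ℝ) {σ : ℝ} (hσ : 0 < σ) (y : E) : 0 < driftKernel ε A σ y :=
  driftKernelProfile_pos _ _ _ hσ _

/-! ### Derivatives -/

/-- Gradient: `Dk(σ, ·)(y) = 2 k dkExp₁ ⟨y, ·⟩`. [folklore] -/
theorem hasFDerivAt_driftKernel (ε A : ℝ) {σ : ℝ} (hσ : 0 < σ) (y : E) :
    HasFDerivAt (driftKernel (E := E) ε A σ)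
      ((2 * (driftKernel ε A σ y * dkExp₁ ε A σ (‖y‖ ^ 2))) • (innerSL ℝ y : E →L[ℝ] ℝ)) y :=
  hasFDerivAt_comp_norm_sq
    (hasDerivAt_driftKernelProfile _ ε A (by positivity : 0 < ‖y‖ ^ 2 + σ))

/-- The gradient as a function. [folklore] -/
theorem fderiv_driftKernel (ε A : ℝ) {σ : ℝ} (hσ : 0 < σ) (y : E) :
    fderiv ℝ (driftKernel (E := E) ε A σ) y =
      (2 * (driftKernel ε A σ y * dkExp₁ ε A σ (‖y‖ ^ 2))) • (innerSL ℝ y : E →L[ℝ] ℝ) :=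
  (hasFDerivAt_driftKernel ε A hσ y).fderiv

/-- Norm of the gradient: `‖Dk‖ = 2 k |dkExp₁| ‖y‖`. [folklore] -/
theorem norm_fderiv_driftKernel (ε A : ℝ) {σ : ℝ} (hσ : 0 < σ) (y : E) :
    ‖fderiv ℝ (driftKernel (E := E) ε A σ) y‖ =
      2 * driftKernel ε A σ y * |dkExp₁ ε A σ (‖y‖ ^ 2)| * ‖y‖ := by
  rw [fderiv_driftKernel ε A hσ y, norm_smul, innerSL_apply_norm, norm_eq_abs, abs_mul, abs_mul,
    abs_two, abs_of_pos (driftKernel_pos ε A hσ y)]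
  ring

/-- Laplacian: `Δk = k (4 (dkExp₁² + dkExp₂) ‖y‖² + 2n dkExp₁)` (radial calculus).
[folklore] -/
theorem laplacian_driftKernel [FiniteDimensional ℝ E] (ε A : ℝ) {σ : ℝ} (hσ : 0 < σ) (y : E) :
    (Δ (driftKernel (E := E) ε A σ)) y = driftKernel ε A σ y *
      (4 * (dkExp₁ ε A σ (‖y‖ ^ 2) ^ 2 + dkExp₂ ε A σ (‖y‖ ^ 2)) * ‖y‖ ^ 2 +
        2 * (Module.finrank ℝ E) * dkExp₁ ε A σ (‖y‖ ^ 2)) := by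
  have h := laplacian_comp_norm_sq (g := driftKernelProfile (Module.finrank ℝ E) ε A σ)
    (g₁ := fun s => driftKernelProfile (Module.finrank ℝ E) ε A σ s * dkExp₁ ε A σ s)
    (U := Ioi (-σ)) isOpen_Ioi
    (fun s hs => hasDerivAt_driftKernelProfile _ ε A (by rw [mem_Ioi] at hs; linarith))
    (z := y) (by rw [mem_Ioi]; nlinarith [sq_nonneg ‖y‖])
    (hasDerivAt_driftKernelProfile₁ _ ε A (by positivity : 0 < ‖y‖ ^ 2 + σ))
  have hfun : driftKernel (E := E) ε A σ =
      fun w : E => driftKernelProfile (Module.finrank ℝ E) ε A σ (‖w‖ ^ 2) := rfl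
  rw [hfun, h]
  ring

/-- `σ`-derivative: `∂_σ k = driftKernelDt`. [folklore] -/
theorem hasDerivAt_driftKernel_sigma (ε A : ℝ) {σ : ℝ} (hσ : 0 < σ) (y : E) :
    HasDerivAt (fun σ' => driftKernel (E := E) ε A σ' y) (driftKernelDt ε A σ y) σ :=
  hasDerivAt_driftKernelProfile_sigma _ ε A hσ (sq_nonneg ‖y‖)

/-- Each slice `driftKernel ε A σ`, `σ > 0`, is smooth. [folklore] -/
theorem contDiff_driftKernel (ε A : ℝ) {σ : ℝ} (hσ : 0 < σ) {N : ℕ∞} :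
    ContDiff ℝ N (driftKernel (E := E) ε A σ) := by
  have h1 : ContDiff ℝ N fun y : E => ‖y‖ ^ 2 := contDiff_norm_sq ℝ
  have h2 : ContDiff ℝ N fun y : E => √(‖y‖ ^ 2 + σ) :=
    (h1.add contDiff_const).sqrt fun y => by positivity
  have h3 : ContDiff ℝ N fun y : E => dkExp (Module.finrank ℝ E) ε A σ (‖y‖ ^ 2) := by
    unfold dkExp
    exact ((h1.neg.div_const _).add
      (contDiff_const.mul (((contDiff_const.mul h2).add contDiff_const).add contDiff_const)))
  unfold driftKernel driftKernelProfile
  exact contDiff_const.mul h3.exp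

/-! ### Joint continuity on `{σ > 0} × E` -/

section Continuity

omit [InnerProductSpace ℝ E] in
/-- `(σ, y) ↦ dkExp n ε A σ ‖y‖²` is continuous on `{σ > 0} × E`. [folklore] -/
theorem continuousOn_dkExp (n ε A : ℝ) :
    ContinuousOn (fun p : ℝ × E => dkExp n ε A p.1 (‖p.2‖ ^ 2)) (Ioi 0 ×ˢ univ) := by
  unfold dkExp
  have hσ : ∀ p ∈ Ioi (0 : ℝ) ×ˢ (univ : Set E), (4 : ℝ) * p.1 ≠ 0 :=
    fun p hp => by have : (0 : ℝ) < p.1 := hp.1; positivity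
  refine ContinuousOn.add ?_ ?_
  · exact ContinuousOn.div (by fun_prop) (by fun_prop) hσ
  · exact Continuous.continuousOn (by fun_prop)

/-- `(σ, y) ↦ driftKernel ε A σ y` is continuous on `{σ > 0} × E`. [folklore] -/
theorem continuousOn_driftKernel (ε A : ℝ) :
    ContinuousOn (fun p : ℝ × E => driftKernel ε A p.1 p.2) (Ioi 0 ×ˢ univ) := by
  unfold driftKernel driftKernelProfile
  refine ContinuousOn.mul ?_ (continuousOn_dkExp _ ε A).rexp
  refine ContinuousOn.rpow_const (by fun_prop) fun p hp => Or.inl ?_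
  have : (0 : ℝ) < p.1 := hp.1
  positivity

omit [InnerProductSpace ℝ E] in
/-- `(σ, y) ↦ dkExp₁ ε A σ ‖y‖²` is continuous on `{σ > 0} × E`. [folklore] -/
theorem continuousOn_dkExp₁ (ε A : ℝ) :
    ContinuousOn (fun p : ℝ × E => dkExp₁ ε A p.1 (‖p.2‖ ^ 2)) (Ioi 0 ×ˢ univ) := by
  unfold dkExp₁
  refine ContinuousOn.add ?_ ?_
  · refine ContinuousOn.div continuousOn_const (by fun_prop) fun p hp => ?_
    have : (0 : ℝ) < p.1 := hp.1
    positivity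
  · refine ContinuousOn.div (by fun_prop) (by fun_prop) fun p hp => ?_
    have : (0 : ℝ) < p.1 := hp.1
    have : 0 < √(‖p.2‖ ^ 2 + p.1) := sqrt_pos.2 (by positivity)
    positivity

omit [InnerProductSpace ℝ E] in
/-- `(σ, y) ↦ dkExp₂ ε A σ ‖y‖²` is continuous on `{σ > 0} × E`. [folklore] -/
theorem continuousOn_dkExp₂ (ε A : ℝ) :
    ContinuousOn (fun p : ℝ × E => dkExp₂ ε A p.1 (‖p.2‖ ^ 2)) (Ioi 0 ×ˢ univ) := by
  unfold dkExp₂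
  refine ContinuousOn.div continuousOn_const (by fun_prop) fun p hp => ?_
  have : (0 : ℝ) < p.1 := hp.1
  have h1 : 0 < ‖p.2‖ ^ 2 + p.1 := by positivity
  have : 0 < √(‖p.2‖ ^ 2 + p.1) := sqrt_pos.2 h1
  positivity

omit [InnerProductSpace ℝ E] in
/-- `(σ, y) ↦ dkExpT n ε A σ ‖y‖²` is continuous on `{σ > 0} × E`. [folklore] -/
theorem continuousOn_dkExpT (n ε A : ℝ) :
    ContinuousOn (fun p : ℝ × E => dkExpT n ε A p.1 (‖p.2‖ ^ 2)) (Ioi 0 ×ˢ univ) := by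
  unfold dkExpT
  have hp1 : ∀ p ∈ Ioi (0 : ℝ) ×ˢ (univ : Set E), (0 : ℝ) < p.1 := fun p hp => hp.1
  refine ContinuousOn.add (ContinuousOn.add ?_ ?_) (continuousOn_const.mul
    (ContinuousOn.add (ContinuousOn.add ?_ ?_) continuousOn_const))
  · exact ContinuousOn.div continuousOn_const (by fun_prop) fun p hp => by
      have := hp1 p hp; positivity
  · exact ContinuousOn.div (by fun_prop) (by fun_prop) fun p hp => by
      have := hp1 p hp; positivity
  · refine ContinuousOn.div continuousOn_const (by fun_prop) fun p hp => ?_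
    have := hp1 p hp
    have : 0 < √(‖p.2‖ ^ 2 + p.1) := sqrt_pos.2 (by positivity)
    positivity
  · refine ContinuousOn.div continuousOn_const (by fun_prop) fun p hp => ?_
    exact (sqrt_pos.2 (hp1 p hp)).ne'

/-- Joint continuity of the gradient `(σ, y) ↦ Dk(σ, ·)(y)` on `{σ > 0} × E`. [folklore] -/
theorem continuousOn_fderiv_driftKernel (ε A : ℝ) :
    ContinuousOn (fun p : ℝ × E => fderiv ℝ (driftKernel ε A p.1) p.2) (Ioi 0 ×ˢ univ) := by
  have h : ∀ p ∈ Ioi (0 : ℝ) ×ˢ (univ : Set E), fderiv ℝ (driftKernel ε A p.1) p.2 =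
      (2 * (driftKernel ε A p.1 p.2 * dkExp₁ ε A p.1 (‖p.2‖ ^ 2))) •
        (innerSL ℝ p.2 : E →L[ℝ] ℝ) := fun p hp => fderiv_driftKernel ε A hp.1 p.2
  refine ContinuousOn.congr ?_ h
  refine ContinuousOn.smul (continuousOn_const.mul ((continuousOn_driftKernel ε A).mul
    (continuousOn_dkExp₁ ε A))) ?_
  exact ((innerSL ℝ : E →L[ℝ] E →L[ℝ] ℝ).continuous.comp continuous_snd).continuousOn

/-- Joint continuity of the Laplacian `(σ, y) ↦ Δk(σ, ·)(y)` on `{σ > 0} × E`. [folklore] -/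
theorem continuousOn_laplacian_driftKernel [FiniteDimensional ℝ E] (ε A : ℝ) :
    ContinuousOn (fun p : ℝ × E => (Δ (driftKernel (E := E) ε A p.1)) p.2) (Ioi 0 ×ˢ univ) := by
  refine ContinuousOn.congr ?_ (fun p hp => laplacian_driftKernel ε A hp.1 p.2)
  refine (continuousOn_driftKernel ε A).mul (ContinuousOn.add ?_ ?_)
  · exact (continuousOn_const.mul (((continuousOn_dkExp₁ ε A).pow 2).add
      (continuousOn_dkExp₂ ε A))).mul (by fun_prop)
  · exact continuousOn_const.mul (continuousOn_dkExp₁ ε A)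

/-- Joint continuity of the `σ`-derivative `(σ, y) ↦ ∂_σ k(σ, y)` on `{σ > 0} × E`.
[folklore] -/
theorem continuousOn_driftKernelDt (ε A : ℝ) :
    ContinuousOn (fun p : ℝ × E => driftKernelDt ε A p.1 p.2) (Ioi 0 ×ˢ univ) :=
  (continuousOn_driftKernel ε A).mul (continuousOn_dkExpT _ ε A)

end Continuity

/-! ### The differential inequality -/

/-- **The drift-robust heat kernels are sub/supersolutions for every drift `‖a‖ ≤ A`**:
for `ε = ±1`, `A ≥ 0`, `σ > 0` and every `y`,
`A ‖∇k_ε(σ, ·)(y)‖ ≤ ε (∂_σ k_ε(σ, y) − Δ k_ε(σ, ·)(y))`. Hence for any vector `a` with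
`‖a‖ ≤ A`: `∂_σ k₊ ≥ Δk₊ − Dk₊[a]` and `∂_σ k₋ ≤ Δk₋ − Dk₋[a]`. [folklore] -/
theorem driftKernel_ineq [FiniteDimensional ℝ E] {ε A σ : ℝ} (hε : ε = 1 ∨ ε = -1)
    (hA : 0 ≤ A) (hσ : 0 < σ) (y : E) :
    A * ‖fderiv ℝ (driftKernel (E := E) ε A σ) y‖ ≤
      ε * (driftKernelDt ε A σ y - (Δ (driftKernel (E := E) ε A σ)) y) := by
  rw [norm_fderiv_driftKernel ε A hσ y, laplacian_driftKernel ε A hσ y, driftKernelDt]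
  have hk := driftKernel_pos ε A hσ y
  have hb := driftKernel_bracket_nonneg (n := (Module.finrank ℝ E : ℝ)) hε (Nat.cast_nonneg _)
    hA hσ (norm_nonneg y)
  set k := driftKernel ε A σ y
  set z := ‖y‖
  have e1 : A * (2 * k * |dkExp₁ ε A σ (z ^ 2)| * z) = k * (2 * A * |dkExp₁ ε A σ (z ^ 2)| * z) := by
    ring
  have e2 : ε * (k * dkExpT (Module.finrank ℝ E) ε A σ (z ^ 2) -
      k * (4 * (dkExp₁ ε A σ (z ^ 2) ^ 2 + dkExp₂ ε A σ (z ^ 2)) * z ^ 2 +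
        2 * (Module.finrank ℝ E) * dkExp₁ ε A σ (z ^ 2))) =
      k * (ε * (dkExpT (Module.finrank ℝ E) ε A σ (z ^ 2) -
        (4 * (dkExp₁ ε A σ (z ^ 2) ^ 2 + dkExp₂ ε A σ (z ^ 2)) * z ^ 2 +
          2 * (Module.finrank ℝ E) * dkExp₁ ε A σ (z ^ 2)))) := by
    ring
  rw [e1, e2]
  exact mul_le_mul_of_nonneg_left hb hk.le

/-- Subsolution form for a concrete drift vector: for `ε = −1`, `‖a‖ ≤ A`,
`∂_σ k₋ ≤ Δ k₋ − Dk₋[a]`. [folklore] -/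
theorem driftKernelDt_le_of_norm_le [FiniteDimensional ℝ E] {A σ : ℝ} (hA : 0 ≤ A)
    (hσ : 0 < σ) (y a : E) (ha : ‖a‖ ≤ A) :
    driftKernelDt (-1) A σ y ≤
      (Δ (driftKernel (E := E) (-1) A σ)) y - fderiv ℝ (driftKernel (E := E) (-1) A σ) y a := by
  have h := driftKernel_ineq (E := E) (ε := -1) (Or.inr rfl) hA hσ y
  have h2 : fderiv ℝ (driftKernel (-1) A σ) y a ≤ A * ‖fderiv ℝ (driftKernel (-1) A σ) y‖ :=
    calc fderiv ℝ (driftKernel (-1) A σ) y a ≤ ‖fderiv ℝ (driftKernel (-1) A σ) y a‖ :=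
          le_norm_self _
      _ ≤ ‖fderiv ℝ (driftKernel (-1) A σ) y‖ * ‖a‖ := ContinuousLinearMap.le_opNorm _ _
      _ ≤ ‖fderiv ℝ (driftKernel (-1) A σ) y‖ * A :=
          mul_le_mul_of_nonneg_left ha (norm_nonneg _)
      _ = A * ‖fderiv ℝ (driftKernel (-1) A σ) y‖ := mul_comm _ _
  linarith

/-! ### Two-sided Gaussian bounds -/

/-- The tilt exponent is nonnegative for `A ≥ 0`, `σ ≥ 0`. [folklore] -/
theorem driftKernel_tilt_nonneg {A σ : ℝ} (hA : 0 ≤ A) (hσ : 0 ≤ σ) (y : E) :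
    0 ≤ A * √(‖y‖ ^ 2 + σ) + 2 * (Module.finrank ℝ E + 1) * A * √σ + 2 * A ^ 2 * σ := by
  positivity

/-- Upper Gaussian bound: `k_ε ≤ heatKernel · e^{A√(‖y‖²+σ) + 2(n+1)A√σ + 2A²σ}` for `|ε| ≤ 1`.
[folklore] -/
theorem driftKernel_le {ε A σ : ℝ} (hε : |ε| ≤ 1) (hA : 0 ≤ A) (hσ : 0 < σ) (y : E) :
    driftKernel ε A σ y ≤ UnboundedOperators.heatKernel σ y *
      exp (A * √(‖y‖ ^ 2 + σ) + 2 * (Module.finrank ℝ E + 1) * A * √σ + 2 * A ^ 2 * σ) := by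
  rw [driftKernel_eq_heatKernel_mul]
  refine mul_le_mul_of_nonneg_left (exp_le_exp.2 ?_)
    (UnboundedOperators.heatKernel_pos hσ y).le
  have hg := driftKernel_tilt_nonneg (E := E) hA hσ.le y
  have := abs_le.1 hε
  nlinarith

/-- Lower Gaussian bound: `heatKernel · e^{−(A√(‖y‖²+σ) + 2(n+1)A√σ + 2A²σ)} ≤ k_ε` for
`|ε| ≤ 1`. [folklore] -/
theorem le_driftKernel {ε A σ : ℝ} (hε : |ε| ≤ 1) (hA : 0 ≤ A) (hσ : 0 < σ) (y : E) :
    UnboundedOperators.heatKernel σ y *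
      exp (-(A * √(‖y‖ ^ 2 + σ) + 2 * (Module.finrank ℝ E + 1) * A * √σ + 2 * A ^ 2 * σ)) ≤
      driftKernel ε A σ y := by
  rw [driftKernel_eq_heatKernel_mul]
  refine mul_le_mul_of_nonneg_left (exp_le_exp.2 ?_)
    (UnboundedOperators.heatKernel_pos hσ y).le
  have hg := driftKernel_tilt_nonneg (E := E) hA hσ.le y
  have := abs_le.1 hε
  nlinarith

end Literature.Analysis.FluidPDE

end
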